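import Summits.MatrixMultiplication.MatrixMultiplication.Theorems.FarEdgeDescentSupportLattice
import Summits.MatrixMultiplication.MatrixMultiplication.Theorems.FarEdgeDescentGaugeFlat
import HarnessLib

/-!
# Far-edge descent, Kernel XI-f — a free diagonal under the zero-weight member: the special
# level has the spectral FLOOR `4`, and `Q̃(𝔖(0)) = 4`

Support for `Summit.MatrixMultiplication.MatrixMultiplication.Theses.FarEdgeDescent`
(aside `SubLogRate`; lens «structural dichotomy (special vs generic)», generation 36).

The zero-weight member `𝔖(0)` of the BCZ line is the one member outside the Coppersmith–Winograd
door and outside the quantum / subrank floor of `FarEdgeDescentStratumPinning` (all weights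
nonzero); so far only the flattening floor `4 ≤ R̃(𝔖(0))` was known for it (X-c).  Here:

* (§1) the four support entries `pt 0 0 1, pt 0 1 0, pt 1 0 0, pt 1 1 1` of `𝔖(0)` form a FREE
  DIAGONAL: their `0/1` tensor `D₄` is a re-indexing of the unit tensor `⟨4⟩`, so `Φ(D₄) = 4`
  for every universal spectral point `Φ`, every field (`spectralPoint_D4`);
* (§2) by the support monotonicity of the special class (XI-e), over every infinite field
  **`4 ≤ Φ(𝔖(0))` for EVERY `Φ ∈ Δ(K)`** (`four_le_spectralPoint_fam_zero`), hence
  **`Q̃(𝔖(0)) = 4 = Q̃(⟨2,2,2⟩)`** (`asymptoticSubrank_fam_zero`; cap by the gauge point XI-d):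
  the zero-weight member is RANK-special (`R = R̲ = 6 < 7`, XI-a) but SUBRANK-generic, and the
  special level `s_Φ = Φ(𝔖(0))` of every spectral point lies in `[4, Φ(𝔖(q_Φ))]`;
* (§3) over `ℂ`: the spectral floor `4 ≤ Φ(T)` now holds on the whole corank-`≤ 1` part of the
  support class (`four_le_spectralPoint_of_corank_le_one`); a universal spectral point that is
  `≤ 4` on the punctured line is EXACTLY `4` at `q = 0` too
  (`spectralPoint_fam_zero_eq_four_of_flat`, unconditional); and under `ω = 2` the per-`Φ`
  summit dichotomy of X-b loses its `q ≠ 0` proviso: `Φ ≡ 4` on the WHOLE line, or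
  `Φ ∈ (4, 5]` off a finite set (`spectral_summit_dichotomy_all`), with `Φ(𝔖(0)) ∈ [4, 5]`
  (`spectralPoint_fam_zero_mem_Icc_of_summit`).

## References

* V. Strassen, *Degeneration and complexity of bilinear maps*, J. reine angew. Math. 413
  (1991) (free / tight supports). [Strassen1991]
* M. Christandl, P. Vrana, J. Zuiddam, J. Amer. Math. Soc. 36 (2023), §1.2, Prop. 1.6.
  [ChristandlVranaZuiddam2023]
* M. Bläser, M. Christandl, J. Zuiddam, arXiv:1705.09652 (2017), Def. 5, Lemma 3.
  [BlaserChristandlZuiddam2017]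
-/

noncomputable section

open scoped BigOperators

set_option linter.dupNamespace false

namespace Summit.MatrixMultiplication.MatrixMultiplication.Theorems.FarEdgeDescentSpecialFloor

open Literature.Computability.AlgebraicComplexity
open Summit.MatrixMultiplication.MatrixMultiplication.Theorems.FarEdgeDescentSignTwist
open Summit.MatrixMultiplication.MatrixMultiplication.Theorems.FarEdgeDescentSignTwistComm
open Summit.MatrixMultiplication.MatrixMultiplication.Theorems.FarEdgeDescentSignTwistCommPow
open Summit.MatrixMultiplication.MatrixMultiplication.Theorems.FarEdgeDescentSignTwistDet
open Summit.MatrixMultiplication.MatrixMultiplication.Theorems.FarEdgeDescentWeightFamily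
open Summit.MatrixMultiplication.MatrixMultiplication.Theorems.FarEdgeDescentStratumPinning
open Summit.MatrixMultiplication.MatrixMultiplication.Theorems.FarEdgeDescentRankOneCoupling
open Summit.MatrixMultiplication.MatrixMultiplication.Theorems.FarEdgeDescentSpectralSublevel
open Summit.MatrixMultiplication.MatrixMultiplication.Theorems.FarEdgeDescentSupportClass
open Summit.MatrixMultiplication.MatrixMultiplication.Theorems.FarEdgeDescentSpecialClass
open Summit.MatrixMultiplication.MatrixMultiplication.Theorems.FarEdgeDescentSpecialValue
open Summit.MatrixMultiplication.MatrixMultiplication.Theorems.FarEdgeDescentSpecialLevel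
open Summit.MatrixMultiplication.MatrixMultiplication.Theorems.FarEdgeDescentSupportLattice
open Summit.MatrixMultiplication.MatrixMultiplication.Theorems.FarEdgeDescentGaugeFlat

/-! ## §1 The free diagonal `D₄ ≅ ⟨4⟩` inside `supp 𝔖(0)` -/

section AnyField

variable {K : Type} [Field K]

/-- First-leaf labels of the diagonal: `inl (0,0) ↦ 0, inl (1,0) ↦ 1, inr (0,0) ↦ 2,
inr (1,0) ↦ 3`. [folklore] -/
def eA : Leaf2 ≃ Fin 4 where
  toFun := Sum.elim (fun z => if z.1 = 0 then 0 else 1) (fun z => if z.1 = 0 then 2 else 3)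
  invFun j := if j = 0 then Sum.inl (0, 0) else if j = 1 then Sum.inl (1, 0)
    else if j = 2 then Sum.inr (0, 0) else Sum.inr (1, 0)
  left_inv := by decide
  right_inv := by decide

/-- Middle labels of the diagonal: `(0,1) ↦ 0, (1,0) ↦ 1, (0,0) ↦ 2, (1,1) ↦ 3`. [folklore] -/
def eX : (Fin 2 × Fin 2) ≃ Fin 4 where
  toFun x := if x = (0, 1) then 0 else if x = (1, 0) then 1 else if x = (0, 0) then 2 else 3
  invFun j := if j = 0 then (0, 1) else if j = 1 then (1, 0) else if j = 2 then (0, 0) else (1, 1)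
  left_inv := by decide
  right_inv := by decide

/-- Second-leaf labels of the diagonal: `inl (1,0) ↦ 0, inl (0,0) ↦ 1, inr (0,0) ↦ 2,
inr (1,0) ↦ 3`. [folklore] -/
def eC : Leaf2 ≃ Fin 4 where
  toFun := Sum.elim (fun z => if z.1 = 0 then 1 else 0) (fun z => if z.1 = 0 then 2 else 3)
  invFun j := if j = 0 then Sum.inl (1, 0) else if j = 1 then Sum.inl (0, 0)
    else if j = 2 then Sum.inr (0, 0) else Sum.inr (1, 0)
  left_inv := by decide
  right_inv := by decide

variable (K) in
/-- The free diagonal `D₄`: the unit tensor `⟨4⟩` re-indexed onto the four support entries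
`pt 0 0 1, pt 0 1 0, pt 1 0 0, pt 1 1 1` of `𝔖(0)`. [cite: Strassen1991, §5] -/
def D4 : Leaf2 → (Fin 2 × Fin 2) → Leaf2 → K :=
  fun a x c => unitTensor K 4 (eA a) (eX x) (eC c)

/-- The diagonal positions lie in `supp 𝔖(1)` and avoid the deleted entry `p₀` (kernel
check on indices). [cite: BlaserChristandlZuiddam2017, Def. 5] -/
theorem D4_cond : ∀ (a : Leaf2) (x : Fin 2 × Fin 2) (c : Leaf2),
    (eA a = eX x ∧ eX x = eC c) → (side a = side c ∧ x = (row a, row c)) ∧ ¬ IsP0 a x c := by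
  decide

/-- `supp D₄ ⊆ supp 𝔖(0)`. [cite: BlaserChristandlZuiddam2017, Def. 5] -/
theorem D4_eq_zero_of_fam_zero {a : Leaf2} {x : Fin 2 × Fin 2} {c : Leaf2}
    (h : fam K 0 a x c = 0) : D4 K a x c = 0 := by
  unfold D4
  rw [unitTensor_apply, if_neg]
  intro hc
  obtain ⟨hcond, hnp⟩ := D4_cond a x c hc
  rcases fam_one_eq_zero_or_isP0 h with h1 | hp
  · exact (fam_one_ne_zero_iff a x c).2 hcond h1
  · exact hnp hp

/-- **`Φ(D₄) = 4`** for every universal spectral point, every field (restriction both ways to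
`⟨4⟩`, normalisation `Φ(⟨4⟩) = 4`). [cite: ChristandlVranaZuiddam2023, §1.2] -/
theorem spectralPoint_D4 {Φ : SpectralMap K} (hΦ : IsUniversalSpectralPoint K Φ) :
    Φ (D4 K) = 4 := by
  have h4 : Φ (unitTensor K 4) = 4 := by exact_mod_cast hΦ.map_unitTensor 4
  refine le_antisymm ?_ ?_
  · exact h4 ▸ hΦ.mono _ _ (tensorRestrictsTo_precomp (unitTensor K 4) eA eX eC)
  · exact h4 ▸ hΦ.mono _ _ (tensorRestrictsTo_of_reindex (unitTensor K 4) eA eX eC)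

/-- `R̃(D₄) = 4`. [cite: ChristandlVranaZuiddam2023, §1.2] -/
theorem asymptoticRank_D4 : asymptoticRank (D4 K) = 4 := by
  obtain ⟨Φ, hΦ, hΦT⟩ := (strassen_duality_asymptoticRank_holds K (D4 K)).2
  rw [← hΦT, spectralPoint_D4 hΦ]

/-! ## §2 The special level has the floor `4`; `Q̃(𝔖(0)) = 4` (infinite field) -/

variable [Infinite K]

/-- **`4 ≤ Φ(𝔖(0))` for every universal spectral point** over an infinite field: `D₄` sits
under `𝔖(0)` in the support lattice of the special class (XI-e monotonicity).
[cite: ChristandlHoeberechtsNieuwboerVranaZuiddam2025, §3] [cite: Strassen1991, §5] -/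
theorem four_le_spectralPoint_fam_zero {Φ : SpectralMap K} (hΦ : IsUniversalSpectralPoint K Φ) :
    (4 : ℝ) ≤ Φ (fam K 0) := by
  rw [← spectralPoint_D4 hΦ]
  exact spectralPoint_mono_support hΦ isSpecial_fam_zero fun a x c h => D4_eq_zero_of_fam_zero h

/-- … hence `4 ≤ Φ(T)` for every corank-ONE member `T` of the support class (exact level
XI-c), every `Φ`, infinite field. [cite: ChristandlHoeberechtsNieuwboerVranaZuiddam2025, §3] -/
theorem four_le_spectralPoint_of_corank_one {Φ : SpectralMap K}
    (hΦ : IsUniversalSpectralPoint K Φ) {T : Leaf2 → (Fin 2 × Fin 2) → Leaf2 → K}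
    (hT : ∀ a x c, fam K 1 a x c = 0 → T a x c = 0) (h : (zeroEntries T).card = 1) :
    (4 : ℝ) ≤ Φ T := by
  rw [(of_zeroEntries_card_eq_one hT h).2 Φ hΦ]
  exact four_le_spectralPoint_fam_zero hΦ

/-- **`Q̃(𝔖(0)) = 4`**: the zero-weight member is asymptotic-SUBRANK-generic (`= Q̃(⟨2,2,2⟩)`),
although rank- and border-rank-special (XI-a).  Floor: subrank duality and §2; cap: the gauge
point `ζ⁽¹⁾(𝔖(0)) = 4` (XI-d). [cite: ChristandlVranaZuiddam2023, Prop. 1.6] -/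
theorem asymptoticSubrank_fam_zero : asymptoticSubrank K (fam K 0) = 4 := by
  obtain ⟨Φ, hΦ, hΦT⟩ := (strassen_duality_asymptoticSubrank_holds K (fam K 0)).2
  refine le_antisymm ?_ ?_
  · have h := (strassen_duality_asymptoticSubrank_holds K (fam K 0)).1 _
      (gaugePoint₁_isUniversalSpectralPoint K)
    rwa [gaugePoint₁_fam] at h
  · rw [← hΦT]
    exact four_le_spectralPoint_fam_zero hΦ

/-- The special level of every spectral point is pinned in `[4, Φ(𝔖(q))+1]` for every `q`
(floor §2, coupling X-a). [cite: Strassen1991, §5] [cite: BlaserChristandlZuiddam2017, Lemma 3] -/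
theorem spectralPoint_fam_zero_window {Φ : SpectralMap K} (hΦ : IsUniversalSpectralPoint K Φ)
    (q : K) : (4 : ℝ) ≤ Φ (fam K 0) ∧ Φ (fam K 0) ≤ Φ (fam K q) + 1 :=
  ⟨four_le_spectralPoint_fam_zero hΦ, spectralPoint_fam_le_add_one hΦ 0 q⟩

end AnyField

/-! ## §3 Over `ℂ`: the floor on corank `≤ 1`, the flat branch at `q = 0`, and under `ω = 2` -/

section Complex

/-- **`4 ≤ Φ(𝔖(q))` for EVERY `q : ℂ`** (`q ≠ 0`: all weights nonzero, StratumPinning; `q = 0`: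
§2). [cite: ChristandlVranaZuiddam2023, Prop. 1.6] [cite: Strassen1991, §5] -/
theorem four_le_spectralPoint_fam {Φ : SpectralMap ℂ} (hΦ : IsUniversalSpectralPoint ℂ Φ)
    (q : ℂ) : (4 : ℝ) ≤ Φ (fam ℂ q) := by
  by_cases hq : q = 0
  · rw [hq]
    exact four_le_spectralPoint_fam_zero hΦ
  · exact four_le_spectralPoint_weightedStar (famW_ne_zero hq) hΦ

/-- **Spectral floor on corank `≤ 1`**: every member of the support class with at most one
vanishing support entry has `Φ(T) ≥ 4` for every `Φ ∈ Δ(ℂ)`.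
[cite: ChristandlVranaZuiddam2023, Prop. 1.6] [cite: BlaserChristandlZuiddam2017, Lemma 3] -/
theorem four_le_spectralPoint_of_corank_le_one {Φ : SpectralMap ℂ}
    (hΦ : IsUniversalSpectralPoint ℂ Φ) {T : Leaf2 → (Fin 2 × Fin 2) → Leaf2 → ℂ}
    (hT : ∀ a x c, fam ℂ 1 a x c = 0 → T a x c = 0) (h : (zeroEntries T).card ≤ 1) :
    (4 : ℝ) ≤ Φ T := by
  rcases Nat.lt_or_ge (zeroEntries T).card 1 with h0 | h1
  · obtain ⟨q, -, -, hΦq⟩ := of_zeroEntries_eq_empty hT (Finset.card_eq_zero.1 (by omega))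
    rw [hΦq Φ hΦ]
    exact four_le_spectralPoint_fam hΦ q
  · exact four_le_spectralPoint_of_corank_one hΦ hT (le_antisymm h h1)

/-- **The flat branch reaches `q = 0`** (unconditional): if a universal spectral point is `≤ 4`
on the punctured line `q ≠ 0`, then `Φ(𝔖(0)) = 4` exactly (all-or-finite sublevel set X-b
gives `≤ 4`; §2 gives `≥ 4`). [cite: ChristandlHoeberechtsNieuwboerVranaZuiddam2025, Cor. 2.4] -/
theorem spectralPoint_fam_zero_eq_four_of_flat {Φ : SpectralMap ℂ}
    (hΦ : IsUniversalSpectralPoint ℂ Φ) (h : ∀ q : ℂ, q ≠ 0 → Φ (fam ℂ q) ≤ 4) :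
    Φ (fam ℂ 0) = 4 := by
  refine le_antisymm ?_ (four_le_spectralPoint_fam_zero hΦ)
  rcases spectral_flatLocus_eq_univ_or_finite hΦ 4 with hu | hfin
  · have h0 : (0 : ℂ) ∈ {q : ℂ | Φ (fam ℂ q) ≤ 4} := by
      rw [hu]
      exact Set.mem_univ _
    exact h0
  · exfalso
    have hinf : ({(0 : ℂ)}ᶜ : Set ℂ).Infinite := (Set.finite_singleton 0).infinite_compl
    exact hinf.mono (fun q hq => h q (by simpa using hq)) hfin

/-- **Under `ω = 2`: `Φ(𝔖(0)) ∈ [4, 5]`** for every universal spectral point (X-a had this for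
`q ≠ 0` only). [conditional: MatrixMultiplication] [cite: ChristandlVranaZuiddam2023, Prop. 1.6] -/
theorem spectralPoint_fam_zero_mem_Icc_of_summit (hS : _root_.MatrixMultiplication)
    {Φ : SpectralMap ℂ} (hΦ : IsUniversalSpectralPoint ℂ Φ) :
    (4 : ℝ) ≤ Φ (fam ℂ 0) ∧ Φ (fam ℂ 0) ≤ 5 :=
  ⟨four_le_spectralPoint_fam_zero hΦ, spectralPoint_fam_le_five_of_summit hS hΦ 0⟩

/-- Under `ω = 2`: `Φ(𝔖(q)) ∈ [4, 5]` for every `q` and every `Φ ∈ Δ(ℂ)`.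
[conditional: MatrixMultiplication] [cite: ChristandlVranaZuiddam2023, Prop. 1.6] -/
theorem spectralPoint_fam_mem_Icc_of_summit_all (hS : _root_.MatrixMultiplication)
    {Φ : SpectralMap ℂ} (hΦ : IsUniversalSpectralPoint ℂ Φ) (q : ℂ) :
    (4 : ℝ) ≤ Φ (fam ℂ q) ∧ Φ (fam ℂ q) ≤ 5 :=
  ⟨four_le_spectralPoint_fam hΦ q, spectralPoint_fam_le_five_of_summit hS hΦ q⟩

/-- **Per-`Φ` summit dichotomy on the WHOLE line** (X-b's `spectral_summit_dichotomy'` without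
its `q ≠ 0` proviso): under `ω = 2`, every universal spectral point is either identically `4` on
the line — the zero-weight member included — or lies in `(4, 5]` off a finite set.
[conditional: MatrixMultiplication]
[cite: ChristandlHoeberechtsNieuwboerVranaZuiddam2025, Cor. 2.4] -/
theorem spectral_summit_dichotomy_all (hS : _root_.MatrixMultiplication) {Φ : SpectralMap ℂ}
    (hΦ : IsUniversalSpectralPoint ℂ Φ) :
    (∀ q : ℂ, Φ (fam ℂ q) = 4) ∨ {q : ℂ | ¬ (4 < Φ (fam ℂ q) ∧ Φ (fam ℂ q) ≤ 5)}.Finite := by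
  rcases spectral_summit_dichotomy' hS hΦ with h | h
  · refine Or.inl fun q => ?_
    by_cases hq : q = 0
    · rw [hq]
      exact spectralPoint_fam_zero_eq_four_of_flat hΦ fun q' hq' => (h q' hq').le
    · exact h q hq
  · exact Or.inr h

/-- **The special value under `ω = 2`, pointwise**: for every `Φ ∈ Δ(ℂ)` and every special
member `T` of the support class whose support contains the free diagonal's (i.e. `supp D₄ ⊆
supp T`), `4 ≤ Φ(T) ≤ 5`. [conditional: MatrixMultiplication]
[cite: ChristandlHoeberechtsNieuwboerVranaZuiddam2025, §3] -/
theorem special_mem_Icc_of_summit (hS : _root_.MatrixMultiplication) {Φ : SpectralMap ℂ}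
    (hΦ : IsUniversalSpectralPoint ℂ Φ) {T : Leaf2 → (Fin 2 × Fin 2) → Leaf2 → ℂ}
    (hT : IsSpecial T) (hD : ∀ a x c, T a x c = 0 → D4 ℂ a x c = 0) :
    (4 : ℝ) ≤ Φ T ∧ Φ T ≤ 5 := by
  refine ⟨?_, (spectralPoint_le_fam_zero_of_isSpecial hΦ hT).trans
    (spectralPoint_fam_le_five_of_summit hS hΦ 0)⟩
  rw [← spectralPoint_D4 hΦ]
  exact spectralPoint_mono_support hΦ hT hD

end Complex

end Summit.MatrixMultiplication.MatrixMultiplication.Theorems.FarEdgeDescentSpecialFloor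

end
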